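import Summits.Ventures.FusionMHD.Bench.SolovevPCFIterMercierR1o16Data3
import Summits.Ventures.FusionMHD.Bench.SolovevPCFIterMercierEdgeThreshold
import Literature.MathematicalPhysics.MHD.SolovevFluxSurfaceGGJQuadratic
import HarnessLib

/-!
# F1 / MERCIER on the INTERIOR flux surface `ρ = 1 / 16·ρ_edge` of the ITER-like PCF Solov'ev equilibrium — KERNEL BRIDGE 1/2:
# the ρ = 1 / 16·ρ_edge loop in the substituted variable (positivity of the surface polynomials, dictionary `u(θ) = U₊`, `|∇Ψ|²·u = 4αρ²P`)
(venture LADDER-GRIDFUSION, rung F1.MERCIER-profile; cell `gridfusion`, seat `gridfusion-sos-6` (g3), 2026-08-27.)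

Same architecture as the edge bridge `…MercierEdge{Subst,Integrals1,Integrals2}` (ITER-like p488688/p489017/p489609, NSTX-like p490356/p490793), now for the interior
Lee–Cerfon surface `r = 1 / 16·a` (`ρ = 1 / 16·ρ_edge`): the §1 half-angle substitution of
the edge file is reused (`open … (theta …)`); §0 positivity of the surface polynomials `UpR1o16/UmR1o16/PpR1o16/PmR1o16` of the Data files
 on `[0,1]`; §2 dictionary `u(θ) = U₊`, `|∇Ψ|²·u = 4αρ²P(cos t)`, `w = κ₀/(2c√u)`; §3 the SEVEN g-free atomic
integrals that the exact quadratic structure (`SolovevFluxSurfaceGGJQuadratic`, p493204) requires: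
`T1 ∫w = (κ₀/c)K₁`, `T2 ∫∂w/∂r = −(κ₀R_a/c)K₂`, `T4 ∫lcQKernelDr = −3R_aK₃`, `T5 ∫w/G = κ₀K₆/(c·4αρ²)`,
`T6a ∫w/(uG) = κ₀K₇/(c·4αρ²)`, `T6b ∫w/u = (κ₀/c)K₄`, `T9 ∫uw/G = κ₀K₈/(c·4αρ²)` — no g-dependent integral is needed.
The threshold file `…MercierR1o16Threshold.lean` turns these into the two-sided certified Mercier threshold of the surface.
HONEST FRAMING: CERTIFIED kernel identities about the MODEL (ideal MHD, analytic fixed-boundary PCF Solov'ev equilibrium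
[cite: PatakiCerfonFreidberg2013, §6.1]); nothing here says a plasma or device is stable. No `decide` in this file.
-/

noncomputable section

open Real MeasureTheory Set intervalIntegral
open Literature.Analysis.ValidatedNumerics Literature.Analysis.ValidatedNumerics.PolyMP
open Literature.Analysis.ValidatedNumerics.ExpPoly (Poly)
open Literature.MathematicalPhysics.MHD Literature.MathematicalPhysics.MHD.Solovev
open Summit.Ventures.FusionMHD.Models.SolovevPCF

namespace Summit.Ventures.FusionMHD.Bench.SolovevPCFIter.MercierR1o16

open Summit.Ventures.FusionMHD.Bench.SolovevPCFIter.MercierEdge (theta theta_arg_sq theta_arg_lt_one cos_theta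
  sin_sq_theta theta_zero theta_one continuous_theta hasDerivAt_theta integral_zero_pi_eq_theta integral_zero_two_pi_eq
  integral_zero_two_pi_eq_theta eval_const_two sqrt_two_sub_pos uIcc01)
open Summit.Ventures.FusionMHD.Bench.SolovevPCFIter.MercierEdge (splus sminus lcAmp_eq)

/-! ## §0 The surface constants and elementary facts on `[0,1]` -/

/-- `4αρ²` on the surface `ρ = 1/25` (`|∇Ψ|²·u = 4αρ²·P`). [folklore] -/
def c4r1o16 : ℝ := (90307009 / 150807195050 : ℝ)

/-- `αρ` on the surface `ρ = 1/25`. [folklore] -/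
def arr1o16 : ℝ := (90307009 / 24129151208 : ℝ)

/-- `c4r1o16 > 0`. [folklore] -/
theorem c4r1o16_pos : 0 < c4r1o16 := by unfold c4r1o16; norm_num

/-- `U₊ > 0` on `[0,1]`. [folklore] -/
theorem UpR1o16_pos {w : ℝ} (hw : w ∈ Icc (0 : ℝ) 1) : 0 < UpR1o16 w := by
  unfold UpR1o16; obtain ⟨h0, h1⟩ := hw; push_cast; nlinarith

/-- `U₋ > 0` everywhere. [folklore] -/
theorem UmR1o16_pos (w : ℝ) : 0 < UmR1o16 w := by
  unfold UmR1o16; push_cast; positivity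

/-- `P₊ > 0` on `[0,1]`. [folklore] -/
theorem PpR1o16_pos {w : ℝ} (hw : w ∈ Icc (0 : ℝ) 1) : 0 < PpR1o16 w := by
  have hU := UpR1o16_pos hw
  obtain ⟨h0, h1⟩ := hw
  rw [PpR1o16_eq]
  have hs : 1 - splus w ^ 2 = w ^ 2 * (2 - w ^ 2) := by unfold splus; ring
  rw [hs]
  rcases eq_or_lt_of_le h0 with h | h
  · subst h
    have : splus 0 = 1 := by unfold splus; norm_num
    rw [this]; norm_num
    positivity
  · have h2 : 0 < w ^ 2 * (2 - w ^ 2) := by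
      have : 0 < 2 - w ^ 2 := by nlinarith
      positivity
    have h3 : 0 < (379234338/3016143901 : ℝ) * UpR1o16 w ^ 2 * (w ^ 2 * (2 - w ^ 2)) := by positivity
    have h4 : 0 ≤ (2257675225/24129151208 : ℝ) * (2 * splus w * UpR1o16 w + (1/25 : ℝ) * (w ^ 2 * (2 - w ^ 2))) ^ 2 := by
      positivity
    linarith

/-- `P₋ > 0` on `[0,1]`. [folklore] -/
theorem PmR1o16_pos {w : ℝ} (hw : w ∈ Icc (0 : ℝ) 1) : 0 < PmR1o16 w := by
  have hU := UmR1o16_pos w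
  obtain ⟨h0, h1⟩ := hw
  rw [PmR1o16_eq]
  have hs : 1 - sminus w ^ 2 = w ^ 2 * (2 - w ^ 2) := by unfold sminus; ring
  rw [hs]
  rcases eq_or_lt_of_le h0 with h | h
  · subst h
    have : sminus 0 = -1 := by unfold sminus; norm_num
    rw [this]; norm_num
    positivity
  · have h2 : 0 < w ^ 2 * (2 - w ^ 2) := by
      have : 0 < 2 - w ^ 2 := by nlinarith
      positivity
    have h3 : 0 < (379234338/3016143901 : ℝ) * UmR1o16 w ^ 2 * (w ^ 2 * (2 - w ^ 2)) := by positivity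
    have h4 : 0 ≤ (2257675225/24129151208 : ℝ) * (2 * sminus w * UmR1o16 w + (1/25 : ℝ) * (w ^ 2 * (2 - w ^ 2))) ^ 2 := by
      positivity
    linarith

/-! ## §2 The printed ρ = 1 / 16·ρ_edge loop of the ITER-like instance in the substituted variable

Lee–Cerfon label of the plasma edge `Ψ = 0`: `r = a = ε/R_a` (`Models/SolovevPCFSafetyFactorProfile`), so
`rR_a = ε = 8/25`, `u(t) = R² = R_a² + 2εcos t = 689/625 + (16/25)cos t`; hence `u(θ(w)) = U₊(w)`,
`u(π − θ(w)) = U₋(w)` (the Qedge file's `UpR1o16/UmR1o16`), and `|∇Ψ|²·u = 4αρ²·P(cos t)` with `P₊/P₋` of Data1. -/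

/-- `(ε/(2R_a))·R_a = ε/2` (the ρ = 1 / 16·ρ_edge label `r = a/2`). [folklore] -/
theorem r1o16_r_mul_Ra : IterLike.ε / IterLike.Ra * (1 / 16) * IterLike.Ra = 1 / 50 := by
  rw [mul_right_comm, div_mul_cancel₀ _ IterLike.Ra_pos.ne']; unfold IterLike.ε; norm_num

/-- The surface label is admissible: `0 < r`, `2r < R_a`. [folklore] -/
theorem r1o16_minorRadius : 0 < IterLike.ε / IterLike.Ra * (1 / 16) ∧ 2 * (IterLike.ε / IterLike.Ra * (1 / 16)) < IterLike.Ra :=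
  ⟨by have := IterLike.edge_minorRadius.1; positivity,
   by have := IterLike.edge_minorRadius; nlinarith [this.1, this.2]⟩

/-- `u(t) = 689 / 625 + (1 / 25)cos t` on the ρ = 1 / 16·ρ_edge loop. [folklore] -/
theorem lcU_r1o16 (t : ℝ) :
    lcU IterLike.Ra (IterLike.ε / IterLike.Ra * (1 / 16)) t = 689 / 625 + 1 / 25 * Real.cos t := by
  unfold lcU
  rw [IterLike.Ra_sq, show 2 * (IterLike.ε / IterLike.Ra * (1 / 16)) * IterLike.Ra * Real.cos t
    = 2 * (IterLike.ε / IterLike.Ra * (1 / 16) * IterLike.Ra) * Real.cos t by ring, r1o16_r_mul_Ra]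
  ring

/-- `u` is even about `π`. [folklore] -/
theorem lcU_two_pi_sub (t : ℝ) :
    lcU IterLike.Ra (IterLike.ε / IterLike.Ra * (1 / 16)) (2 * π - t) = lcU IterLike.Ra (IterLike.ε / IterLike.Ra * (1 / 16)) t := by
  rw [lcU_r1o16, lcU_r1o16, Real.cos_two_pi_sub]

/-- `u(θ(w)) = U₊(w)`. [folklore] -/
theorem lcU_theta {w : ℝ} (hw : w ∈ Icc (0 : ℝ) 1) :
    lcU IterLike.Ra (IterLike.ε / IterLike.Ra * (1 / 16)) (theta w) = UpR1o16 w := by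
  rw [lcU_r1o16, cos_theta hw]; unfold UpR1o16; push_cast; ring

/-- `u(π − θ(w)) = U₋(w)`. [folklore] -/
theorem lcU_pi_sub_theta {w : ℝ} (hw : w ∈ Icc (0 : ℝ) 1) :
    lcU IterLike.Ra (IterLike.ε / IterLike.Ra * (1 / 16)) (π - theta w) = UmR1o16 w := by
  rw [lcU_r1o16, Real.cos_pi_sub, cos_theta hw]; unfold UmR1o16; push_cast; ring

/-- `u > 0` on the ρ = 1 / 16·ρ_edge loop. [folklore] -/
theorem lcU_r1o16_pos (t : ℝ) : 0 < lcU IterLike.Ra (IterLike.ε / IterLike.Ra * (1 / 16)) t :=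
  lcU_pos IterLike.Ra_pos r1o16_minorRadius.1.le r1o16_minorRadius.2 t

/-- **`|∇Ψ|²·u = 4αρ²·P(cos t)` on the ρ = 1 / 16·ρ_edge loop**, `P(s) = α(2su + ρ(1−s²))² + 4|d₃|u²(1−s²)` — the structure
behind Data1's `P₊/P₋` (`κ₀² = E = α/|d₃|`, `(2caR_a)² = c²ρ²`, `c = 4α`). [folklore] -/
theorem lcGradSq_r1o16 {g : ℝ} (hg : g ≠ 0) (t : ℝ) :
    lcGradSq IterLike.kappa0 g IterLike.Ra (IterLike.q0 g) (IterLike.ε / IterLike.Ra * (1 / 16)) t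
        * lcU IterLike.Ra (IterLike.ε / IterLike.Ra * (1 / 16)) t
      = c4r1o16 * ((2257675225/24129151208 : ℝ)
          * (2 * Real.cos t * lcU IterLike.Ra (IterLike.ε / IterLike.Ra * (1 / 16)) t + (1/25 : ℝ) * (1 - Real.cos t ^ 2)) ^ 2
          + (379234338/3016143901 : ℝ) * lcU IterLike.Ra (IterLike.ε / IterLike.Ra * (1 / 16)) t ^ 2 * (1 - Real.cos t ^ 2)) := by
  have hu := lcU_r1o16_pos t
  unfold lcGradSq
  rw [show (2 * (IterLike.kappa0 * g / (2 * IterLike.Ra ^ 3 * IterLike.q0 g)) * (IterLike.ε / IterLike.Ra * (1 / 16))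
      * IterLike.Ra) = 2 * (IterLike.kappa0 * g / (2 * IterLike.Ra ^ 3 * IterLike.q0 g))
      * (IterLike.ε / IterLike.Ra * (1 / 16) * IterLike.Ra) by ring, lcAmp_eq hg,
    show IterLike.ε / IterLike.Ra * (1 / 16) * IterLike.Ra * Real.sin t ^ 2
      = (IterLike.ε / IterLike.Ra * (1 / 16) * IterLike.Ra) * Real.sin t ^ 2 by ring, r1o16_r_mul_Ra,
    IterLike.kappa0_sq, Real.sin_sq]
  unfold IterLike.elongSq c4r1o16
  set r₀ := IterLike.ε / IterLike.Ra * (1 / 16) with hr₀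
  field_simp
  ring

/-- `|∇Ψ|²(θ(w)) = 4αρ²·P₊(w)/U₊(w)`. [folklore] -/
theorem lcGradSq_theta {g : ℝ} (hg : g ≠ 0) {w : ℝ} (hw : w ∈ Icc (0 : ℝ) 1) :
    lcGradSq IterLike.kappa0 g IterLike.Ra (IterLike.q0 g) (IterLike.ε / IterLike.Ra * (1 / 16)) (theta w)
      = c4r1o16 * PpR1o16 w / UpR1o16 w := by
  have hu : 0 < UpR1o16 w := UpR1o16_pos hw
  rw [eq_div_iff hu.ne', ← lcU_theta hw, lcGradSq_r1o16 hg, lcU_theta hw, cos_theta hw, PpR1o16_eq]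
  unfold splus
  ring

/-- `|∇Ψ|²(π − θ(w)) = 4αρ²·P₋(w)/U₋(w)`. [folklore] -/
theorem lcGradSq_pi_sub_theta {g : ℝ} (hg : g ≠ 0) {w : ℝ} (hw : w ∈ Icc (0 : ℝ) 1) :
    lcGradSq IterLike.kappa0 g IterLike.Ra (IterLike.q0 g) (IterLike.ε / IterLike.Ra * (1 / 16)) (π - theta w)
      = c4r1o16 * PmR1o16 w / UmR1o16 w := by
  have hu : 0 < UmR1o16 w := UmR1o16_pos w
  rw [eq_div_iff hu.ne', ← lcU_pi_sub_theta hw, lcGradSq_r1o16 hg, lcU_pi_sub_theta hw, Real.cos_pi_sub,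
    cos_theta hw, PmR1o16_eq]
  unfold sminus
  ring

/-- `|∇Ψ|²` is even about `π` on the ρ = 1 / 16·ρ_edge loop. [folklore] -/
theorem lcGradSq_two_pi_sub {g : ℝ} (hg : g ≠ 0) (t : ℝ) :
    lcGradSq IterLike.kappa0 g IterLike.Ra (IterLike.q0 g) (IterLike.ε / IterLike.Ra * (1 / 16)) (2 * π - t)
      = lcGradSq IterLike.kappa0 g IterLike.Ra (IterLike.q0 g) (IterLike.ε / IterLike.Ra * (1 / 16)) t := by
  have hu := lcU_r1o16_pos t
  have h1 := lcGradSq_r1o16 hg (2 * π - t)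
  have h2 := lcGradSq_r1o16 hg t
  rw [lcU_two_pi_sub, Real.cos_two_pi_sub] at h1
  exact mul_right_cancel₀ hu.ne' (h1.trans h2.symm)

/-- The density `w(t) = κ₀/(2c√u)` on the ρ = 1 / 16·ρ_edge loop. [folklore] -/
theorem lcAvgWeight_r1o16 {g : ℝ} (hg : g ≠ 0) (t : ℝ) :
    lcAvgWeight IterLike.kappa0 g IterLike.Ra (IterLike.q0 g) (IterLike.ε / IterLike.Ra * (1 / 16)) t
      = IterLike.kappa0 / (2 * (2257675225 / 6032287802 : ℝ))
          * (Real.sqrt (lcU IterLike.Ra (IterLike.ε / IterLike.Ra * (1 / 16)) t))⁻¹ := by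
  unfold lcAvgWeight
  rw [lcAmp_eq hg, div_eq_mul_inv, div_eq_mul_inv, mul_inv]
  ring

/-- `∂w/∂r(t) = −κ₀R_a cos t/(2c·u√u)` on the ρ = 1 / 16·ρ_edge loop. [folklore] -/
theorem lcAvgWeightDr_r1o16 {g : ℝ} (hg : g ≠ 0) (t : ℝ) :
    lcAvgWeightDr IterLike.kappa0 g IterLike.Ra (IterLike.q0 g) (IterLike.ε / IterLike.Ra * (1 / 16)) t
      = -(IterLike.kappa0 * IterLike.Ra / (2 * (2257675225 / 6032287802 : ℝ)))
          * (Real.cos t * (lcU IterLike.Ra (IterLike.ε / IterLike.Ra * (1 / 16)) t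
              * Real.sqrt (lcU IterLike.Ra (IterLike.ε / IterLike.Ra * (1 / 16)) t))⁻¹) := by
  unfold lcAvgWeightDr
  rw [lcAmp_eq hg]
  ring




end Summit.Ventures.FusionMHD.Bench.SolovevPCFIter.MercierR1o16

end
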